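import Literature.MathematicalPhysics.QuantumLattice.HubbardTTPrimeGrandCanonicalThermalStatesKMSRows
import Literature.MathematicalPhysics.QuantumLattice.TorusSectorPartitionFnTiling
import Literature.MathematicalPhysics.QuantumLattice.HubbardTTPrimeBoxHamiltonian
import HarnessLib

/-!
# The grand-canonical partition function of an OPEN `ℓ × ℓ` box of the `t–t'` Hubbard model is bounded by the
# thermodynamic-limit pressure: `log Re Ξ^open_ℓ(β; t,t',U; μ,h) ≤ ℓ²·P(β; t,t',U; μ,h) + 2·log(ℓ² + 1)`

Topic `Literature/MathematicalPhysics/QuantumLattice`; the grand-canonical, every-`ℓ` form of the cluster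
variational principle (`TorusSectorPartitionFnTiling.lean`: the canonical partition function of a torus made of
`K × K` open boxes dominates the `K²`-th power of the box's canonical partition function) combined with the
EXISTENCE of the Zeeman grand-canonical pressure
`P = gcPressureTT'Zeeman β t t' U μ h = lim_L L⁻² log Re Tr e^{−β(H_L − μN − hM)}`
(`HubbardTTPrimeGrandCanonicalPressureZeeman`, `…GibbsMixture.tendsto_log_partitionFn_gcTorus_div_sq_comp`):

* §1 `log_partitionFn_spinSector_openBox_add_le_sq_mul_gcPressure` — for every box sector `(a₀, b₀)`,
  `log Re Z_β(H^open_ℓ; a₀, b₀) + β(μ(a₀ + b₀) + h(a₀ − b₀)) ≤ ℓ²·P` (tile the `Kℓ`-torus by `K²` boxes, keep ONE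
  sector term of the torus' grand-canonical sum, divide by `(Kℓ)²`, `K → ∞`);
* §2 `log_partitionFn_openBox_gc_le` — **`log Re Ξ^open_ℓ ≤ ℓ²·P + 2·log(ℓ² + 1)`** (`Ξ^open_ℓ = Tr e^{−β(H^open_ℓ − μN − hM)}`
  is the sum of the `(ℓ² + 1)²` sector terms of §1), i.e. the open-box grand-canonical pressure never exceeds the
  thermodynamic one by more than `2 log(ℓ²+1)/ℓ²`;
* §3 the same for the LOCAL grand-canonical Hamiltonian `K_B = gcLocalHamiltonianTT' B t t' U μ h` of the box
  `B = [0,ℓ)² ⊂ ℤ²` of the infinite-volume formalism (`partitionFn_gcLocalHamiltonianTT'_halfOpenBox_re`: its partition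
  function IS `Ξ^open_ℓ`, by the site bijection `[0,ℓ)² ≃ Fin ℓ ×ₗ Fin ℓ` of `HubbardOpenBoxVersusTorus`;
  `log_partitionFn_gcLocalHamiltonianTT'_halfOpenBox_le`).

USE: the upper half of the Gibbs variational principle in the thermodynamic limit
(`HubbardTTPrimeThermalStatesEntropyDensity.lean`: `S(ω_B) ≤ β Re ω(K_B) + log Re Tr e^{−βK_B}` for every state, and the
right-hand side is `≤ β Re ω(K_B) + ℓ² P + 2 log(ℓ²+1)`). Everything is PROVED; no definition, no named fact.

## Mathlib / tree search

REUSED: `mul_log_partitionFn_openBox_le_rectTorus`, `partitionFn_spinSector_re_pos`, `partitionFn_spinSector_re_nonneg`,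
`nonempty_spinConfig` (`TorusSectorPartitionFnTiling`); `partitionFn_sub_sub_re_eq_sum`, `preservesSectors_hamiltonian`
(`HubbardTTPrimeGrandCanonicalPressureZeeman`, `HubbardLiebConfig`); `partitionFn_gcTorusHamiltonianTT'_re_eq_rect`,
`tendsto_log_partitionFn_gcTorus_div_sq_comp` (`HubbardTTPrimeGrandCanonicalGibbsMixture`); `gcLocalHamiltonianTT'`
(`…ThermalStatesKMSRows`); `hubbardTTPrime_localHamiltonian_eq_twoGraph`, `rectBoxGraph_adj_iff_polyGraph_adj`,
`rectBoxDiagGraph_adj_iff_diagAdj` (`HubbardTTPrimeBoxHamiltonian`), `exists_equiv_polySite_halfOpenBox_two`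
(`HubbardOpenBoxVersusTorus`); `relabel_hamiltonian`, `relabel_mapEquiv_totalNumber`, `relabel_mapEquiv_numberOp`,
`partitionFn_relabel` (`FermionRelabelling`); `card_rectSites`. `lean search 'openBox.*gcPressure|Ξ.*open'`: nothing (2026-08-27) —
the tree's open-box/torus comparisons are canonical (`TorusSectorGibbsOpenBoxBound`) or ground-state (`HubbardOpenBoxVersusTorus`).

## References

* D. Ruelle, *Statistical Mechanics: Rigorous Results* (1969), §3.3 Prop. 3.3.2, §3.4 (sub-box estimates; the grand-canonical
  pressure). [cite: Ruelle1969, §3.3]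
* R. B. Israel, *Convexity in the Theory of Lattice Gases* (1979), Lemma II.3.1, Thm. I.2.4 (pressure with free vs periodic
  boundary conditions). [cite: Israel1979, Lemma II.3.1]
* B. Simon, *The Statistical Mechanics of Lattice Gases* I (1993), §II.8 (boundary conditions and the pressure). [cite: Simon1993, §II.8]
-/

noncomputable section

namespace Literature.MathematicalPhysics.QuantumLattice

open Matrix Finset HubbardWave0 Literature.Probability.LatticeModels ThermodynamicLimit LiebThm1
open _root_.Filter
open scoped _root_.Topology ComplexOrder BigOperators

/-! ### §1 One sector of the open box against the thermodynamic pressure -/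

section Sector

/-- The open-box `t–t'` Hamiltonian preserves the spin sectors. [cite: LiebPRL1989, proof of Theorem 1] -/
private theorem preservesSectors_hubbardOpenBoxTT'' (a b : ℕ) (t t' U : ℝ) : PreservesSectors (hubbardOpenBoxTT' a b t t' U) := by
  unfold hubbardOpenBoxTT'
  exact (preservesSectors_hamiltonian _ t U).add (preservesSectors_hamiltonian _ t' 0)

/-- The rectangular-torus `t–t'` Hamiltonian preserves the spin sectors. [cite: LiebPRL1989, proof of Theorem 1] -/
private theorem preservesSectors_hubbardRectTorusTT'' (a b : ℕ) (t t' U : ℝ) :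
    PreservesSectors (hubbardRectTorusTT' a b t t' U) := by
  unfold hubbardRectTorusTT'
  exact (preservesSectors_hamiltonian _ t U).add (preservesSectors_hamiltonian _ t' 0)

/-- **One sector term is below the grand-canonical partition function** (rectangular torus): for `A, B ≤ |Λ|`,
`e^{β(μ(A+B) + h(A−B))} · Re Z_β(H; A, B) ≤ Re Z_β(H − μN − hM)` (all other terms of the sector sum are `≥ 0`).
[cite: Ruelle1969, §3.4] -/
theorem exp_mul_partitionFn_spinSector_le_partitionFn_gc {Λ : Type*} [LinearOrder Λ] [Fintype Λ]
    {H : Matrix (Finset (Orb Λ)) (Finset (Orb Λ)) ℂ} (hP : PreservesSectors H) (hH : H.IsHermitian) (β μ hz : ℝ)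
    {A B : ℕ} (hA : A ≤ Fintype.card Λ) (hB : B ≤ Fintype.card Λ) :
    Real.exp (β * μ * (A + B) + β * hz * (A - B)) * (partitionFn β (spinSectorHamiltonian A B H)).re ≤
      (partitionFn β (H - (μ : ℂ) • totalNumber - (hz : ℂ) • spinImbalance)).re := by
  rw [partitionFn_sub_sub_re_eq_sum hP β μ hz]
  have hA' : A ∈ Finset.range (Fintype.card Λ + 1) := Finset.mem_range.2 (by omega)
  have hB' : B ∈ Finset.range (Fintype.card Λ + 1) := Finset.mem_range.2 (by omega)
  have hnn : ∀ a b : ℕ, 0 ≤ Real.exp (β * μ * (a + b) + β * hz * (a - b)) *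
      (partitionFn β (spinSectorHamiltonian a b H)).re :=
    fun a b => mul_nonneg (Real.exp_pos _).le (partitionFn_spinSector_re_nonneg a b hH β)
  calc Real.exp (β * μ * (A + B) + β * hz * (A - B)) * (partitionFn β (spinSectorHamiltonian A B H)).re
      ≤ ∑ b ∈ Finset.range (Fintype.card Λ + 1),
          Real.exp (β * μ * (A + b) + β * hz * (A - b)) * (partitionFn β (spinSectorHamiltonian A b H)).re :=
        Finset.single_le_sum (f := fun b : ℕ => Real.exp (β * μ * (A + b) + β * hz * (A - b)) *
          (partitionFn β (spinSectorHamiltonian A b H)).re) (fun b _ => hnn A b) hB'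
    _ ≤ ∑ a ∈ Finset.range (Fintype.card Λ + 1), ∑ b ∈ Finset.range (Fintype.card Λ + 1),
          Real.exp (β * μ * (a + b) + β * hz * (a - b)) * (partitionFn β (spinSectorHamiltonian a b H)).re :=
        Finset.single_le_sum (f := fun a : ℕ => ∑ b ∈ Finset.range (Fintype.card Λ + 1),
          Real.exp (β * μ * (a + b) + β * hz * (a - b)) * (partitionFn β (spinSectorHamiltonian a b H)).re)
          (fun a _ => Finset.sum_nonneg fun b _ => hnn a b) hA'

variable {β : ℝ} (hβ : 0 ≤ β) (t t' : ℝ) {U : ℝ} (hU : 0 ≤ U) (μ hz : ℝ)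
include hβ hU

/-- **One box sector against the thermodynamic pressure.** For `ℓ ≥ 1`, `β ≥ 0`, `U ≥ 0` and every box sector
`a₀, b₀ ≤ ℓ²`: `log Re Z_β(H^open_ℓ; a₀, b₀) + β(μ(a₀ + b₀) + h(a₀ − b₀)) ≤ ℓ² · P(β; t,t',U; μ,h)`.
Proof: for `K ≥ 2`, `K² log Re Z_β(H^open_ℓ; a₀,b₀) ≤ log Re Z_β(H^torus_{Kℓ}; K²a₀, K²b₀)`
(`mul_log_partitionFn_openBox_le_rectTorus`), the sector term is below `Re Ξ^torus_{Kℓ}`, and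
`(Kℓ)⁻² log Re Ξ^torus_{Kℓ} → P`. [cite: Ruelle1969, §3.3] [cite: Israel1979, Lemma II.3.1] -/
theorem log_partitionFn_spinSector_openBox_add_le_sq_mul_gcPressure {ℓ : ℕ} (hℓ : 1 ≤ ℓ) {a₀ b₀ : ℕ}
    (ha₀ : a₀ ≤ ℓ * ℓ) (hb₀ : b₀ ≤ ℓ * ℓ) :
    Real.log (partitionFn β (spinSectorHamiltonian a₀ b₀ (hubbardOpenBoxTT' ℓ ℓ t t' U))).re +
        (β * μ * (a₀ + b₀) + β * hz * (a₀ - b₀)) ≤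
      (ℓ : ℝ) ^ 2 * gcPressureTT'Zeeman β t t' U μ hz := by
  set z : ℝ := (partitionFn β (spinSectorHamiltonian a₀ b₀ (hubbardOpenBoxTT' ℓ ℓ t t' U))).re with hz_def
  set c : ℝ := β * μ * (a₀ + b₀) + β * hz * (a₀ - b₀) with hc
  -- the side sequence `L_j = (j+2)·ℓ`
  set Ls : ℕ → ℕ := fun j => (j + 2) * ℓ with hLs_def
  have hLs : Tendsto Ls atTop atTop := by
    refine tendsto_atTop_mono (fun j => ?_) tendsto_id
    show j ≤ (j + 2) * ℓ
    nlinarith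
  have hlim := tendsto_log_partitionFn_gcTorus_div_sq_comp hβ t t' hU μ hz hLs
  -- for every `j`: `(log z + c)/ℓ² ≤ (L_j)⁻² log Re Ξ^torus_{L_j}`
  have hle : ∀ j : ℕ, (Real.log z + c) / (ℓ : ℝ) ^ 2 ≤
      Real.log (partitionFn β (gcTorusHamiltonianTT' (Ls j) t t' U μ hz)).re / ((Ls j : ℕ) : ℝ) ^ 2 := by
    intro j
    set K : ℕ := j + 2 with hK
    have hK2 : 2 ≤ K := by omega
    have hKpos : (0 : ℝ) < K := by positivity
    have hℓpos : (0 : ℝ) < ℓ := by exact_mod_cast hℓ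
    -- tiling
    have htile := mul_log_partitionFn_openBox_le_rectTorus ℓ ℓ K K hK2 hK2 t t' U hβ ha₀ hb₀
    -- the torus sector term is below the grand-canonical partition function of the rectangular torus
    have hcardT : Fintype.card (Fin (K * ℓ) ×ₗ Fin (K * ℓ)) = (K * ℓ) * (K * ℓ) := card_rectSites _ _
    have hA : K * K * a₀ ≤ Fintype.card (Fin (K * ℓ) ×ₗ Fin (K * ℓ)) := by
      rw [hcardT]; calc K * K * a₀ ≤ K * K * (ℓ * ℓ) := Nat.mul_le_mul_left _ ha₀
        _ = K * ℓ * (K * ℓ) := by ring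
    have hB : K * K * b₀ ≤ Fintype.card (Fin (K * ℓ) ×ₗ Fin (K * ℓ)) := by
      rw [hcardT]; calc K * K * b₀ ≤ K * K * (ℓ * ℓ) := Nat.mul_le_mul_left _ hb₀
        _ = K * ℓ * (K * ℓ) := by ring
    have hterm := exp_mul_partitionFn_spinSector_le_partitionFn_gc (preservesSectors_hubbardRectTorusTT'' _ _ t t' U)
      (hubbardRectTorusTT'_isHermitian _ _ t t' U) β μ hz hA hB
    rw [← partitionFn_gcTorusHamiltonianTT'_re_eq_rect] at hterm
    -- positivity of the torus sector term
    have hzpos : 0 < z := by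
      haveI : Nonempty (Subtype (spinConfig (Λ := Fin ℓ ×ₗ Fin ℓ) a₀ b₀)) :=
        nonempty_spinConfig (by rw [card_rectSites]; exact ha₀) (by rw [card_rectSites]; exact hb₀)
      exact partitionFn_spinSector_re_pos (hubbardOpenBoxTT'_isHermitian ℓ ℓ t t' U) β
    set Z : ℝ := (partitionFn β (spinSectorHamiltonian (K * K * a₀) (K * K * b₀)
      (hubbardRectTorusTT' (K * ℓ) (K * ℓ) t t' U))).re with hZ
    have hZpos : 0 < Z := by
      have h2 := pow_partitionFn_openBox_le_rectTorus ℓ ℓ K K hK2 hK2 t t' U hβ a₀ b₀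
      exact lt_of_lt_of_le (pow_pos hzpos _) h2
    -- `K²(log z + c) ≤ log Re Ξ^torus`
    have hΞpos : 0 < (partitionFn β (gcTorusHamiltonianTT' (K * ℓ) t t' U μ hz)).re :=
      lt_of_lt_of_le (mul_pos (Real.exp_pos _) hZpos) hterm
    have h4 : (β * μ * ((K * K * a₀ : ℕ) + (K * K * b₀ : ℕ)) + β * hz * ((K * K * a₀ : ℕ) - (K * K * b₀ : ℕ))) +
        Real.log Z ≤ Real.log (partitionFn β (gcTorusHamiltonianTT' (K * ℓ) t t' U μ hz)).re := by
      have := Real.log_le_log (mul_pos (Real.exp_pos _) hZpos) hterm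
      rwa [Real.log_mul (Real.exp_pos _).ne' hZpos.ne', Real.log_exp] at this
    have h5 : (K * K : ℝ) * (Real.log z + c) ≤ Real.log (partitionFn β (gcTorusHamiltonianTT' (K * ℓ) t t' U μ hz)).re := by
      have e : (β * μ * ((K * K * a₀ : ℕ) + (K * K * b₀ : ℕ)) + β * hz * ((K * K * a₀ : ℕ) - (K * K * b₀ : ℕ))) =
          (K * K : ℝ) * c := by rw [hc]; push_cast; ring
      rw [e] at h4
      nlinarith [h4, htile]
    -- divide by `(Kℓ)²`
    have hLsj : Ls j = K * ℓ := by simp only [hLs_def, hK]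
    rw [hLsj]
    have hcast : (((K * ℓ : ℕ) : ℝ)) ^ 2 = (K * K : ℝ) * (ℓ : ℝ) ^ 2 := by push_cast; ring
    rw [hcast, div_le_div_iff₀ (by positivity) (by positivity)]
    calc (Real.log z + c) * ((K * K : ℝ) * (ℓ : ℝ) ^ 2) = (K * K : ℝ) * (Real.log z + c) * (ℓ : ℝ) ^ 2 := by ring
      _ ≤ Real.log (partitionFn β (gcTorusHamiltonianTT' (K * ℓ) t t' U μ hz)).re * (ℓ : ℝ) ^ 2 :=
        mul_le_mul_of_nonneg_right h5 (by positivity)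
  have hfinal : (Real.log z + c) / (ℓ : ℝ) ^ 2 ≤ gcPressureTT'Zeeman β t t' U μ hz :=
    ge_of_tendsto hlim (Eventually.of_forall hle)
  have hℓ2 : (0 : ℝ) < (ℓ : ℝ) ^ 2 := by positivity
  rw [div_le_iff₀ hℓ2] at hfinal
  linarith

end Sector

/-! ### §2 The open-box grand-canonical partition function -/

section OpenBox

variable {β : ℝ} (hβ : 0 ≤ β) (t t' : ℝ) {U : ℝ} (hU : 0 ≤ U) (μ hz : ℝ)
include hβ hU

/-- **The open-box grand-canonical pressure is below the thermodynamic pressure, up to `2 log(ℓ²+1)/ℓ²`**: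
for `ℓ ≥ 1`, `β ≥ 0`, `U ≥ 0`,
`log Re Tr e^{−β(H^open_ℓ − μN − hM)} ≤ ℓ² · P(β; t,t',U; μ,h) + 2 · log(ℓ² + 1)`
(the `(ℓ²+1)²` sector terms are each `≤ e^{ℓ²P}` by §1). [cite: Ruelle1969, §3.4] [cite: Simon1993, §II.8] -/
theorem log_partitionFn_openBox_gc_le {ℓ : ℕ} (hℓ : 1 ≤ ℓ) :
    Real.log (partitionFn β (hubbardOpenBoxTT' ℓ ℓ t t' U - (μ : ℂ) • totalNumber - (hz : ℂ) • spinImbalance)).re ≤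
      (ℓ : ℝ) ^ 2 * gcPressureTT'Zeeman β t t' U μ hz + 2 * Real.log ((ℓ : ℝ) ^ 2 + 1) := by
  set P : ℝ := gcPressureTT'Zeeman β t t' U μ hz with hPdef
  have hH : (hubbardOpenBoxTT' ℓ ℓ t t' U).IsHermitian := hubbardOpenBoxTT'_isHermitian ℓ ℓ t t' U
  have hcard : Fintype.card (Fin ℓ ×ₗ Fin ℓ) = ℓ * ℓ := card_rectSites ℓ ℓ
  have hsum := partitionFn_sub_sub_re_eq_sum (preservesSectors_hubbardOpenBoxTT'' ℓ ℓ t t' U) β μ hz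
  rw [hcard] at hsum
  -- each term is `≤ e^{ℓ²P}`
  have hterm : ∀ a ∈ Finset.range (ℓ * ℓ + 1), ∀ b ∈ Finset.range (ℓ * ℓ + 1),
      Real.exp (β * μ * (a + b) + β * hz * (a - b)) *
          (partitionFn β (spinSectorHamiltonian a b (hubbardOpenBoxTT' ℓ ℓ t t' U))).re ≤
        Real.exp ((ℓ : ℝ) ^ 2 * P) := by
    intro a ha b hb
    have ha' : a ≤ ℓ * ℓ := by have := Finset.mem_range.1 ha; omega
    have hb' : b ≤ ℓ * ℓ := by have := Finset.mem_range.1 hb; omega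
    haveI : Nonempty (Subtype (spinConfig (Λ := Fin ℓ ×ₗ Fin ℓ) a b)) :=
      nonempty_spinConfig (by rw [card_rectSites]; exact ha') (by rw [card_rectSites]; exact hb')
    have hzpos : 0 < (partitionFn β (spinSectorHamiltonian a b (hubbardOpenBoxTT' ℓ ℓ t t' U))).re :=
      partitionFn_spinSector_re_pos hH β
    have h1 := log_partitionFn_spinSector_openBox_add_le_sq_mul_gcPressure hβ t t' hU μ hz hℓ ha' hb'
    have h2 : Real.log (Real.exp (β * μ * (a + b) + β * hz * (a - b)) *
        (partitionFn β (spinSectorHamiltonian a b (hubbardOpenBoxTT' ℓ ℓ t t' U))).re) ≤ (ℓ : ℝ) ^ 2 * P := by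
      rw [Real.log_mul (Real.exp_pos _).ne' hzpos.ne', Real.log_exp]
      linarith
    exact (Real.log_le_iff_le_exp (mul_pos (Real.exp_pos _) hzpos)).1 h2
  -- sum of `(ℓ²+1)²` terms
  have hle : (partitionFn β (hubbardOpenBoxTT' ℓ ℓ t t' U - (μ : ℂ) • totalNumber - (hz : ℂ) • spinImbalance)).re ≤
      ((ℓ * ℓ + 1 : ℕ) : ℝ) * (((ℓ * ℓ + 1 : ℕ) : ℝ) * Real.exp ((ℓ : ℝ) ^ 2 * P)) := by
    rw [hsum]
    calc ∑ a ∈ Finset.range (ℓ * ℓ + 1), ∑ b ∈ Finset.range (ℓ * ℓ + 1),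
          Real.exp (β * μ * (a + b) + β * hz * (a - b)) *
            (partitionFn β (spinSectorHamiltonian a b (hubbardOpenBoxTT' ℓ ℓ t t' U))).re
        ≤ ∑ a ∈ Finset.range (ℓ * ℓ + 1), ∑ b ∈ Finset.range (ℓ * ℓ + 1), Real.exp ((ℓ : ℝ) ^ 2 * P) :=
          Finset.sum_le_sum fun a ha => Finset.sum_le_sum fun b hb => hterm a ha b hb
      _ = ((ℓ * ℓ + 1 : ℕ) : ℝ) * (((ℓ * ℓ + 1 : ℕ) : ℝ) * Real.exp ((ℓ : ℝ) ^ 2 * P)) := by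
          rw [Finset.sum_const, Finset.card_range, nsmul_eq_mul, Finset.sum_const, Finset.card_range, nsmul_eq_mul]
  -- positivity of the grand-canonical partition function (the `(0,0)` sector term is `≥ 1 > 0`)
  have hpos : 0 < (partitionFn β (hubbardOpenBoxTT' ℓ ℓ t t' U - (μ : ℂ) • totalNumber - (hz : ℂ) • spinImbalance)).re := by
    haveI : Nonempty (Subtype (spinConfig (Λ := Fin ℓ ×ₗ Fin ℓ) 0 0)) :=
      nonempty_spinConfig (Nat.zero_le _) (Nat.zero_le _)
    have h0 : 0 < (partitionFn β (spinSectorHamiltonian 0 0 (hubbardOpenBoxTT' ℓ ℓ t t' U))).re :=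
      partitionFn_spinSector_re_pos hH β
    have h1 := exp_mul_partitionFn_spinSector_le_partitionFn_gc (preservesSectors_hubbardOpenBoxTT'' ℓ ℓ t t' U) hH β μ hz
      (A := 0) (B := 0) (Nat.zero_le _) (Nat.zero_le _)
    exact lt_of_lt_of_le (mul_pos (Real.exp_pos _) h0) h1
  have hcast : ((ℓ * ℓ + 1 : ℕ) : ℝ) = (ℓ : ℝ) ^ 2 + 1 := by push_cast; ring
  rw [hcast] at hle
  have hq : 0 < (ℓ : ℝ) ^ 2 + 1 := by positivity
  calc Real.log (partitionFn β (hubbardOpenBoxTT' ℓ ℓ t t' U - (μ : ℂ) • totalNumber - (hz : ℂ) • spinImbalance)).re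
      ≤ Real.log (((ℓ : ℝ) ^ 2 + 1) * (((ℓ : ℝ) ^ 2 + 1) * Real.exp ((ℓ : ℝ) ^ 2 * P))) := Real.log_le_log hpos hle
    _ = (ℓ : ℝ) ^ 2 * P + 2 * Real.log ((ℓ : ℝ) ^ 2 + 1) := by
        rw [Real.log_mul hq.ne' (mul_pos hq (Real.exp_pos _)).ne', Real.log_mul hq.ne' (Real.exp_pos _).ne',
          Real.log_exp]
        ring

end OpenBox

/-! ### §3 The local grand-canonical Hamiltonian of the box `[0,ℓ)² ⊂ ℤ²` -/

section LocalBox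

/-- `U_f M U_f⁻¹ = M` along a site bijection (`M = Σₓ (nₓ↑ − nₓ↓)`). [cite: BratteliRobinsonII1997, §5.2.2, Thm. 5.2.5] -/
private theorem relabel_mapEquiv_spinImbalance' {Λ Λ' : Type*} [LinearOrder Λ] [Fintype Λ] [LinearOrder Λ']
    [Fintype Λ'] (f : Λ ≃ Λ') :
    relabel (Orb.mapEquiv f) (spinImbalance : Matrix (Finset (Orb Λ)) (Finset (Orb Λ)) ℂ) = spinImbalance := by
  rw [spinImbalance, relabel_sum]
  simp_rw [relabel_sub, relabel_mapEquiv_numberOp]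
  exact Equiv.sum_comp f (fun x => numberOp x 0 - numberOp x 1)

/-- **The local grand-canonical Hamiltonian of `[0,ℓ)²` is the open-box grand-canonical Hamiltonian** (up to the
site bijection `[0,ℓ)² ≃ Fin ℓ ×ₗ Fin ℓ` reading off the coordinates): its partition function is `Ξ^open_ℓ`.
[cite: LeBlancEtAl2015, eq. (1)] -/
theorem partitionFn_gcLocalHamiltonianTT'_halfOpenBox (ℓ : ℕ) (β t t' U μ hz : ℝ) :
    partitionFn β (gcLocalHamiltonianTT' (halfOpenBox 2 ℓ) t t' U μ hz) =
      partitionFn β (hubbardOpenBoxTT' ℓ ℓ t t' U - (μ : ℂ) • totalNumber - (hz : ℂ) • spinImbalance) := by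
  classical
  obtain ⟨f, hf0, hf1⟩ := exists_equiv_polySite_halfOpenBox_two ℓ
  have hK : relabel (Orb.mapEquiv f) (gcLocalHamiltonianTT' (halfOpenBox 2 ℓ) t t' U μ hz) =
      hubbardOpenBoxTT' ℓ ℓ t t' U - (μ : ℂ) • totalNumber - (hz : ℂ) • spinImbalance := by
    rw [gcLocalHamiltonianTT'_eq, relabel_sub, relabel_sub, relabel_smul, relabel_smul, relabel_mapEquiv_totalNumber,
      relabel_mapEquiv_spinImbalance',
      hubbardTTPrime_localHamiltonian_eq_twoGraph t' t U (halfOpenBox 2 ℓ) ((rectBoxDiagGraph ℓ ℓ).comap f)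
        (fun a b => rectBoxDiagGraph_adj_iff_diagAdj f hf0 hf1 a b),
      relabel_add, relabel_hamiltonian (polyGraph (halfOpenBox 2 ℓ)) (rectBoxGraph ℓ ℓ) f
        (rectBoxGraph_adj_iff_polyGraph_adj f hf0 hf1) t U,
      relabel_hamiltonian ((rectBoxDiagGraph ℓ ℓ).comap f) (rectBoxDiagGraph ℓ ℓ) f (fun _ _ => Iff.rfl) t' 0,
      hubbardOpenBoxTT']
  rw [← hK, partitionFn_relabel]

variable {β : ℝ} (hβ : 0 ≤ β) (t t' : ℝ) {U : ℝ} (hU : 0 ≤ U) (μ hz : ℝ)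
include hβ hU

/-- **The grand-canonical partition function of the local Hamiltonian of `[0,ℓ)²` against the thermodynamic
pressure**: `log Re Tr e^{−βK_{[0,ℓ)²}} ≤ ℓ² · P(β; t,t',U; μ,h) + 2 log(ℓ²+1)` (`ℓ ≥ 1`, `β ≥ 0`, `U ≥ 0`).
[cite: Ruelle1969, §3.4] [cite: Israel1979, Lemma II.3.1] -/
theorem log_partitionFn_gcLocalHamiltonianTT'_halfOpenBox_le {ℓ : ℕ} (hℓ : 1 ≤ ℓ) :
    Real.log (partitionFn β (gcLocalHamiltonianTT' (halfOpenBox 2 ℓ) t t' U μ hz)).re ≤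
      (ℓ : ℝ) ^ 2 * gcPressureTT'Zeeman β t t' U μ hz + 2 * Real.log ((ℓ : ℝ) ^ 2 + 1) := by
  rw [partitionFn_gcLocalHamiltonianTT'_halfOpenBox]
  exact log_partitionFn_openBox_gc_le hβ t t' hU μ hz hℓ

omit hβ hU in
/-- `K_Λ` is Hermitian. [cite: BratteliRobinsonII1997, Thm. 6.2.4] -/
theorem gcLocalHamiltonianTT'_isHermitian (Λ : Finset (Site 2)) (t t' U μ hz : ℝ) :
    (gcLocalHamiltonianTT' Λ t t' U μ hz).IsHermitian := by
  rw [gcLocalHamiltonianTT'_eq]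
  exact isHermitian_sub_sub (hubbardTTPrime_localHamiltonian_isHermitian_and_commute t t' U Λ).1 μ hz

omit hβ hU in
/-- Positivity: `0 < Re Tr e^{−βK_Λ}`. [cite: Israel1979, Lemma II.3.1] -/
theorem partitionFn_gcLocalHamiltonianTT'_re_pos (Λ : Finset (Site 2)) (β t t' U μ hz : ℝ) :
    0 < (partitionFn β (gcLocalHamiltonianTT' Λ t t' U μ hz)).re :=
  partitionFn_re_pos (gcLocalHamiltonianTT'_isHermitian Λ t t' U μ hz) β

end LocalBox

end Literature.MathematicalPhysics.QuantumLattice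

end
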